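import Mathlib.Analysis.InnerProductSpace.l2Space
import Mathlib.Topology.Algebra.InfiniteSum.Order
import Mathlib.Topology.Algebra.InfiniteSum.Real
import Literature.Analysis.OperatorTheory.HilbertSchmidtOrthogonalSum
import HarnessLib

/-!
# Ky Fan's lower bound for the two lowest levels of a diagonal form (infinite dimensions)

Topic `Literature/Analysis/InnerProduct`; companion of `KyFanTwoSmallest.lean` (which treats a
symmetric operator on a *finite-dimensional* real inner product space through Mathlib's spectral
theorem). Here the form is given *diagonally* along a family of unit vectors `(v_k)_{k ∈ ι}` of a
real or complex inner product space, `q(x) = Σ_k μ_k |⟪v_k, x⟫|²` (an unconditional sum, `ι`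
arbitrary), as is the case for an operator with compact resolvent expanded in an orthonormal
eigenbasis, or for a second-quantised `dΓ(ε) = Σ_p ε_p a_p† a_p` expanded in occupation-number
vectors. If `μ_{k₀} ≤ m₂ ≤ μ_k` for all `k ≠ k₀` (so `μ_{k₀}` is the lowest level and `m₂` a lower
bound for all the others, e.g. the second lowest level), then for every orthonormal pair `x₁ ⊥ x₂`
obeying Parseval along `(v_k)`,

  `μ_{k₀} + m₂ ≤ q(x₁) + q(x₂)`                                    (`kyFan_two_le_of_hasSum_norm_inner_sq`)

— Ky Fan's minimum principle for `k = 2` [Ky Fan 1949, Thm. 1; Reed–Simon IV, Thm. XIII.1–XIII.2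
(min–max)], in the form "the sum of the two lowest eigenvalues is a lower bound for
`⟨x₁, A x₁⟩ + ⟨x₂, A x₂⟩` over orthonormal pairs", which is how the tree phrases two-level spectral
statements variationally (`Literature.MathematicalPhysics.QuantumManyBody.BoseGas.kyFanTwo`,
`…BoccatoEtAl2019_firstGap_GP`, `…BoccatoEtAl2019Acta_firstExcitation`: there `λ₁ + λ₂` of a
many-body Hamiltonian is *defined* as this infimum, and the comparison operator
`𝒟 = Σ_p ε_p a_p† a_p` of [Boccato–Brennecke–Cenatiempo–Schlein 2019, §6, (6.1)] is diagonal in the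
occupation basis with `ν₁ = 0`, `ν₂ = ε_{2π}`).

The proof is the rearrangement inequality behind Ky Fan's theorem, in a form valid for infinite
index sets: with the weights `w_k = |⟪v_k, x₁⟫|² + |⟪v_k, x₂⟫|²` one has `0 ≤ w_k ≤ ‖v_k‖² = 1`
(Bessel's inequality for the orthonormal pair `x₁, x₂` tested against `v_k`) and `Σ_k w_k = 2`
(Parseval), and for such weights `Σ_k μ_k w_k ≥ 2m₂ - (m₂ - μ_{k₀}) w_{k₀} ≥ μ_{k₀} + m₂`
(`hasSum_mul_ge_two_lowest`). Everything is stated with `HasSum` hypotheses (no summability side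
conditions are hidden in junk values of `tsum`).

* `hasSum_mul_ge_two_lowest`, `sum_mul_ge_two_lowest` — the weight inequality (unconditional sums /
  finite types); this is the layer used by models carrying their own inner product
  (e.g. the holomorphic Fock model `MvPolynomial ι ℂ` with `fockInner`);
* `norm_inner_sq_add_norm_inner_sq_le` — Bessel for a pair: `|⟪e, x₁⟫|² + |⟪e, x₂⟫|² ≤ ‖e‖²`;
* `kyFan_two_le_of_hasSum_norm_inner_sq` — the lower bound for unit vectors `v_k` and an
  orthonormal pair satisfying Parseval along `v` (`Σ_k |⟪v_k, xⱼ⟫|² = 1`);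
* `kyFan_two_le_hilbertBasis` — the same for a `HilbertBasis` (Parseval automatic);
* `hasSum_mul_norm_inner_sq_orthonormal` — `q(v_j) = μ_j` for an orthonormal family, so that the
  bound is attained at the pair `(v_{k₀}, v_{k₁})` when `μ_{k₁} = m₂` (`kyFan_two_attained_pair`).

No definitions, no named facts. Mathlib has Bessel (`Orthonormal.sum_inner_products_le`) and
Parseval (`HilbertBasis.hasSum_inner_mul_inner`; norm-square form
`Literature.Analysis.OperatorTheory.hasSum_norm_inner_sq`) but no min–max / Ky Fan statement in
infinite dimensions (searched `minMax`, `Rayleigh`, `KyFan`, `courantFischer`).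

## References

* Ky Fan, *On a theorem of Weyl concerning eigenvalues of linear transformations I*, Proc. Nat.
  Acad. Sci. USA 35 (1949) 652–655, Thm. 1. [folklore form used here]
* M. Reed, B. Simon, *Methods of Modern Mathematical Physics IV*, Thm. XIII.1–2 (min–max).
* C. Boccato, C. Brennecke, S. Cenatiempo, B. Schlein, Acta Math. 222 (2019), §6, (6.1)–(6.2)
  [BoccatoEtAl2019Acta] — the use of the principle this file serves.
-/

noncomputable section

open scoped InnerProductSpace
open Finset

namespace Literature.Analysis.InnerProduct

/-! ### The weight inequality -/

/-- **Rearrangement bound behind Ky Fan's principle, unconditional sums.** Let `μ : ι → ℝ` have a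
lowest entry `μ k₀ ≤ m₂` with `m₂ ≤ μ k` for every `k ≠ k₀`, and let `w : ι → ℝ` be weights with
`0 ≤ w k ≤ 1` and `Σ_k w k = 2`. If `Σ_k μ k * w k` converges (unconditionally) to `s`, then
`μ k₀ + m₂ ≤ s`: indeed `μ_k w_k ≥ m₂ w_k - [k = k₀](m₂ - μ_{k₀}) w_{k₀}` termwise, so
`s ≥ 2m₂ - (m₂ - μ_{k₀}) w_{k₀} ≥ 2m₂ - (m₂ - μ_{k₀})`. [folklore] -/
theorem hasSum_mul_ge_two_lowest {ι : Type*} {μ w : ι → ℝ} {k₀ : ι} {m₂ s : ℝ}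
    (hk₀ : μ k₀ ≤ m₂) (hμ : ∀ k, k ≠ k₀ → m₂ ≤ μ k)
    (hw0 : ∀ k, 0 ≤ w k) (hw1 : ∀ k, w k ≤ 1) (hw2 : HasSum w 2)
    (hs : HasSum (fun k => μ k * w k) s) :
    μ k₀ + m₂ ≤ s := by
  classical
  have hg : HasSum (fun k => m₂ * w k - (if k = k₀ then (m₂ - μ k₀) * w k₀ else 0))
      (m₂ * 2 - (m₂ - μ k₀) * w k₀) :=
    (hw2.mul_left m₂).sub (hasSum_ite_eq k₀ ((m₂ - μ k₀) * w k₀))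
  have hle : ∀ k, m₂ * w k - (if k = k₀ then (m₂ - μ k₀) * w k₀ else 0) ≤ μ k * w k := by
    intro k
    by_cases hk : k = k₀
    · subst hk
      simp only [if_true]
      nlinarith [hw0 k]
    · simp only [hk, if_false, sub_zero]
      exact mul_le_mul_of_nonneg_right (hμ k hk) (hw0 k)
  have h := hasSum_le hle hg hs
  have h' : (m₂ - μ k₀) * w k₀ ≤ m₂ - μ k₀ :=
    mul_le_of_le_one_right (sub_nonneg.2 hk₀) (hw1 k₀)
  linarith

/-- **Rearrangement bound, finite index type**: `μ k₀ + m₂ ≤ Σ_k μ k * w k` for weights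
`0 ≤ w ≤ 1` with `Σ w = 2` and levels `μ k₀ ≤ m₂ ≤ μ k` (`k ≠ k₀`). [folklore] -/
theorem sum_mul_ge_two_lowest {ι : Type*} [Fintype ι] {μ w : ι → ℝ} {k₀ : ι} {m₂ : ℝ}
    (hk₀ : μ k₀ ≤ m₂) (hμ : ∀ k, k ≠ k₀ → m₂ ≤ μ k)
    (hw0 : ∀ k, 0 ≤ w k) (hw1 : ∀ k, w k ≤ 1) (hw2 : ∑ k, w k = 2) :
    μ k₀ + m₂ ≤ ∑ k, μ k * w k :=
  hasSum_mul_ge_two_lowest hk₀ hμ hw0 hw1 (hw2 ▸ hasSum_fintype w) (hasSum_fintype _)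

/-! ### Bessel for a pair, and the Ky Fan lower bound in an inner product space -/

variable {𝕜 : Type*} [RCLike 𝕜] {E : Type*} [NormedAddCommGroup E] [InnerProductSpace 𝕜 E]

/-- An orthonormal pair as an orthonormal family on `Fin 2`. [folklore] -/
theorem orthonormal_pair {x₁ x₂ : E} (h₁ : ‖x₁‖ = 1) (h₂ : ‖x₂‖ = 1) (h₁₂ : ⟪x₁, x₂⟫_𝕜 = 0) :
    Orthonormal 𝕜 ![x₁, x₂] := by
  rw [orthonormal_vecCons_iff]
  refine ⟨h₁, fun i => ?_, ?_⟩
  · fin_cases i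
    simpa using h₁₂
  · rw [orthonormal_vecCons_iff]
    exact ⟨h₂, fun i => Fin.elim0 i, Orthonormal.of_isEmpty _⟩

/-- **Bessel's inequality for an orthonormal pair**: `|⟪e, x₁⟫|² + |⟪e, x₂⟫|² ≤ ‖e‖²` whenever
`x₁, x₂` are unit vectors with `⟪x₁, x₂⟫ = 0`. [folklore] -/
theorem norm_inner_sq_add_norm_inner_sq_le {x₁ x₂ : E} (h₁ : ‖x₁‖ = 1) (h₂ : ‖x₂‖ = 1)
    (h₁₂ : ⟪x₁, x₂⟫_𝕜 = 0) (e : E) :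
    ‖⟪e, x₁⟫_𝕜‖ ^ 2 + ‖⟪e, x₂⟫_𝕜‖ ^ 2 ≤ ‖e‖ ^ 2 := by
  have h := (orthonormal_pair h₁ h₂ h₁₂).sum_inner_products_le e (s := Finset.univ)
  rw [Fin.sum_univ_two] at h
  simp only [Matrix.cons_val_zero, Matrix.cons_val_one] at h
  rwa [← inner_conj_symm x₁ e, ← inner_conj_symm x₂ e, RCLike.norm_conj, RCLike.norm_conj] at h

/-- **Ky Fan's lower bound for two levels, diagonal form along unit vectors.** Let `(v_k)` be unit
vectors of an inner product space over `ℝ` or `ℂ`, `μ : ι → ℝ` levels with `μ k₀ ≤ m₂ ≤ μ k` for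
all `k ≠ k₀`, and `x₁, x₂` an orthonormal pair each satisfying Parseval along `v`
(`Σ_k |⟪v_k, xⱼ⟫|² = 1`, e.g. `xⱼ` in the closed span of an orthonormal `v`). If the diagonal
form `q(xⱼ) = Σ_k μ_k |⟪v_k, xⱼ⟫|²` converges to `sⱼ` (`j = 1, 2`), then `μ k₀ + m₂ ≤ s₁ + s₂`:
the sum of the two lowest levels bounds the form on orthonormal pairs from below (Ky Fan 1949,
Thm. 1 for `k = 2`; the min–max principle). [folklore] -/
theorem kyFan_two_le_of_hasSum_norm_inner_sq {ι : Type*} {v : ι → E} (hv : ∀ k, ‖v k‖ = 1)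
    {μ : ι → ℝ} {k₀ : ι} {m₂ : ℝ} (hk₀ : μ k₀ ≤ m₂) (hμ : ∀ k, k ≠ k₀ → m₂ ≤ μ k)
    {x₁ x₂ : E} (h₁ : ‖x₁‖ = 1) (h₂ : ‖x₂‖ = 1) (h₁₂ : ⟪x₁, x₂⟫_𝕜 = 0)
    (hP₁ : HasSum (fun k => ‖⟪v k, x₁⟫_𝕜‖ ^ 2) 1)
    (hP₂ : HasSum (fun k => ‖⟪v k, x₂⟫_𝕜‖ ^ 2) 1)
    {s₁ s₂ : ℝ} (hs₁ : HasSum (fun k => μ k * ‖⟪v k, x₁⟫_𝕜‖ ^ 2) s₁)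
    (hs₂ : HasSum (fun k => μ k * ‖⟪v k, x₂⟫_𝕜‖ ^ 2) s₂) :
    μ k₀ + m₂ ≤ s₁ + s₂ := by
  refine hasSum_mul_ge_two_lowest (w := fun k => ‖⟪v k, x₁⟫_𝕜‖ ^ 2 + ‖⟪v k, x₂⟫_𝕜‖ ^ 2)
    hk₀ hμ (fun k => by positivity) (fun k => ?_) ?_ ?_
  · simpa [hv k] using norm_inner_sq_add_norm_inner_sq_le h₁ h₂ h₁₂ (v k)
  · simpa [one_add_one_eq_two] using hP₁.add hP₂
  · simpa [mul_add] using hs₁.add hs₂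

/-- **Ky Fan's lower bound for two levels along a Hilbert basis**: for a Hilbert basis `b`, levels
`μ k₀ ≤ m₂ ≤ μ k` (`k ≠ k₀`) and an orthonormal pair `x₁, x₂` on which the diagonal form
`Σ_k μ_k |⟪b_k, xⱼ⟫|²` converges to `sⱼ`, `μ k₀ + m₂ ≤ s₁ + s₂` (Parseval is automatic).
[folklore] -/
theorem kyFan_two_le_hilbertBasis {ι : Type*} (b : HilbertBasis ι 𝕜 E)
    {μ : ι → ℝ} {k₀ : ι} {m₂ : ℝ} (hk₀ : μ k₀ ≤ m₂) (hμ : ∀ k, k ≠ k₀ → m₂ ≤ μ k)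
    {x₁ x₂ : E} (h₁ : ‖x₁‖ = 1) (h₂ : ‖x₂‖ = 1) (h₁₂ : ⟪x₁, x₂⟫_𝕜 = 0)
    {s₁ s₂ : ℝ} (hs₁ : HasSum (fun k => μ k * ‖⟪b k, x₁⟫_𝕜‖ ^ 2) s₁)
    (hs₂ : HasSum (fun k => μ k * ‖⟪b k, x₂⟫_𝕜‖ ^ 2) s₂) :
    μ k₀ + m₂ ≤ s₁ + s₂ := by
  have hP₁ := Literature.Analysis.OperatorTheory.hasSum_norm_inner_sq b x₁
  have hP₂ := Literature.Analysis.OperatorTheory.hasSum_norm_inner_sq b x₂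
  rw [h₁, one_pow] at hP₁
  rw [h₂, one_pow] at hP₂
  exact kyFan_two_le_of_hasSum_norm_inner_sq (fun k => b.orthonormal.norm_eq_one k) hk₀ hμ h₁ h₂
    h₁₂ hP₁ hP₂ hs₁ hs₂

/-! ### The diagonal values: the bound is attained on basis pairs -/

/-- For an orthonormal family `v`, the diagonal form takes the value `μ j` at `v j`:
`Σ_k μ_k |⟪v_k, v_j⟫|² = μ_j` (a one-term sum). [folklore] -/
theorem hasSum_mul_norm_inner_sq_orthonormal {ι : Type*} {v : ι → E} (hv : Orthonormal 𝕜 v)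
    (μ : ι → ℝ) (j : ι) :
    HasSum (fun k => μ k * ‖⟪v k, v j⟫_𝕜‖ ^ 2) (μ j) := by
  classical
  have h : (fun k => μ k * ‖⟪v k, v j⟫_𝕜‖ ^ 2) = fun k => if k = j then μ j else 0 := by
    funext k
    rw [orthonormal_iff_ite.1 hv k j]
    split_ifs with hkj
    · subst hkj; simp
    · simp
  rw [h]
  exact hasSum_ite_eq j (μ j)

/-- Parseval is trivially satisfied by a member of an orthonormal family:
`Σ_k |⟪v_k, v_j⟫|² = 1`. [folklore] -/
theorem hasSum_norm_inner_sq_orthonormal {ι : Type*} {v : ι → E} (hv : Orthonormal 𝕜 v) (j : ι) :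
    HasSum (fun k => ‖⟪v k, v j⟫_𝕜‖ ^ 2) 1 := by
  simpa using hasSum_mul_norm_inner_sq_orthonormal hv (fun _ => (1 : ℝ)) j

/-- **Attainment on a basis pair.** For an orthonormal family `v` and indices `k₀ ≠ k₁`, the pair
`(v k₀, v k₁)` is orthonormal and the diagonal form sums to `μ k₀ + μ k₁` on it; hence when
`μ k₁ = m₂` is the second lowest level, Ky Fan's lower bound `μ k₀ + m₂` is an equality for this
pair (the infimum over orthonormal pairs *is* the sum of the two lowest levels). [folklore] -/
theorem kyFan_two_attained_pair {ι : Type*} {v : ι → E} (hv : Orthonormal 𝕜 v) (μ : ι → ℝ)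
    {k₀ k₁ : ι} (h : k₀ ≠ k₁) :
    ‖v k₀‖ = 1 ∧ ‖v k₁‖ = 1 ∧ ⟪v k₀, v k₁⟫_𝕜 = 0 ∧
      HasSum (fun k => μ k * ‖⟪v k, v k₀⟫_𝕜‖ ^ 2 + μ k * ‖⟪v k, v k₁⟫_𝕜‖ ^ 2) (μ k₀ + μ k₁) :=
  ⟨hv.norm_eq_one k₀, hv.norm_eq_one k₁, hv.inner_eq_zero h,
    (hasSum_mul_norm_inner_sq_orthonormal hv μ k₀).add
      (hasSum_mul_norm_inner_sq_orthonormal hv μ k₁)⟩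

end Literature.Analysis.InnerProduct

end
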